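/-
Origin: expansion seat `prover-pub-hodgecm-mc-binder-2-g18-0`, handover #94 2026-08-20T21:56Z md5 55b37708728c (NEW; 182 l.; ns `HodgeCM.SignRecipe` (+ `….GoodCtx`) + `HodgeCM.Model`; (J4a-pin): DATA def **`SignRecipe.lineType (a : L) (ha : conjRingHomK L a = a) (ha0 : a ≠ 0) : CMType L := {τ ∣ 0 < Im τ(η_L a)}`** (theta-3-g22's `Φ^δ(a)`; CM-type axiom from `im_embedding_eta_mul` + `embedding_eta_im_ne_zero` + `re_embedding_ne_zero_of_conj_eq`), `mem_lineType_iff` (Iff.rfl), `lineType_val` (rfl), `lineType_congr`; `lineType_eq_liftType_false (hb : orientBitι L ι₁ = h) (hs : SignsForced h K L j ι₁ Ψ D) (horbit) i : lineType (D.a i) _ _ = liftType false K L j ι₁ (Ψ i)` (= #83 `posImSet_imagUnit_mul_eq_liftType_false_of_orbit` as a CMType identity); `GoodCtx.orbit_of_isGalois`, `GoodCtx.self_mem_lineType (hc : GoodCtx (orientBitι L ι₁) ι₁ c) i : ι₁ ∈ lineType (c.D.a i)` (#83 `im_ι₁_eta_mul_a_pos`), **`GoodCtx.liftTyped_lineType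 [IsGalois ℚ L] (hc) i : ∃ j, ι₁.comp j = c.σ ∧ lineType (c.D.a i) _ _ = liftType false c.K L j ι₁ (c.Ψ i)`** (THE (J4a) CLAUSE VERBATIM for `Φ := Φ^δ(a_i)`) + `…_of_isNormalClosure (hN : IsNormalClosure ℚ c.K L)`; `Model.liftTyped_of_scalar_eq (scalar : Char → L) (hreal) (hne) (typeOf) (htypeOf : ∀ μ, typeOf μ = lineType (scalar μ) _ _) (hN) (hc) (hμ : scalar μ = c.D.a i) : ∃ j, ι₁.comp j = c.σ ∧ typeOf μ = liftType false c.K L j ι₁ (c.Ψ i)`; **`Model.hJ_at_of_scalar_eq`** = #92 `hJ_at_of_liftTyped` ∘ that: from `∃ S, (∀ μ ∈ S, scalar μ = c.D.a i) ∧ Q S` to the junction's `∃ S, clause 1 ∧ clause 2 ∧ Q S` under `SignRecipe.GoodCtx (orientBitι L ι₁) ι₁ c` + E's `h6`. CERT lane farm lean-direct over the RUN-63 PKG oleans + overlay olean of #92: rc 0 ∕ 6 s ∕ 0 warn ∕ 0 proof holes; `#print axioms` 11 ∕ 11 ⊆ trio, `proof-holeAx` 0 (`g18/farm/logs/ax_lt.log`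 26083c98c768); FQN grep vs PKG + headline list 0 ∕ 11. NAME LIST (theorems): `HodgeCM.SignRecipe.lineType_eq_liftType_false` · `HodgeCM.SignRecipe.GoodCtx.liftTyped_lineType` · `HodgeCM.Model.hJ_at_of_scalar_eq`. (`HOME/mc/pub-hodgecm-mc-binder-2/g18/stage64/HodgeCM/Model/Binders/JLiuLineType.lean`, md5 55b37708728c, 182 lines);
landed by the second packager p2 gen 14 (p2-g14) in gate run 64 as `HodgeCM/Model/Binders/JLiuLineType.lean` (verbatim).
-/
/-
Copyright (c) 2026 the pub-hodgecm formalisation cell (harness21).  New file, not vendored.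
Origin: session prover-pub-hodgecm-mc-binder-2-g18-0 (unit pub-hodgecm-mc-binder-2-g18, BINDER PROVER gen 18 of lineage mc-binder-2;
content lane (J-Liu-Θ), (J4a-pin) — the δ-positive CM type of a hermitian line as a KERNEL OBJECT, and the (J4a) clause of the
junction's `hJ` DISCHARGED for every character whose type is read off the line scalar `a_i` of the corner), 2026-08-20.
Intended final place: `HodgeCM/Model/Binders/JLiuLineType.lean` (NEW additive leaf; imports binder-2 #83 `Model/HypCensus/JLiuDeltaSign`
(RUN 56), binder-2 #92 `Model/Binders/JLiuHJOfLiftType` (RUN 64) and `CM/ReflexInflate`; nothing imports it).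
-/
import Summits.HodgeConjecture.HodgeCM.Model.HypCensus.JLiuDeltaSign
import Summits.HodgeConjecture.HodgeCM.Model.Binders.JLiuHJOfLiftType
import Summits.HodgeConjecture.HodgeCM.CM.ReflexInflate

set_option autoImplicit false

/-!
# (J4a-pin): the δ-positive type `Φ^δ(a)` of a line scalar, and the (J4a) clause from `scalar = a_i`

The (J3) junction's `hJ` (axioms-1 #2/#3, binder-1 #R116/#R120) is fed, after binder-2 #92/#93, by a finite set `S` of characters
each satisfying the (J4a) TYPING `∃ j, ι₁ ∘ j = c.σ ∧ typeOf μ = liftType false c.K L j ι₁ (c.Ψ i)` plus the (J4) families.  The theta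
lane's READ of [Liu21] (theta-3-g22 `J4A-THETA-READ.g22.md` (L1)–(L5), §0 display; theta-3-g26 STATUS 2026-08-20T20:36:15Z (i)) computes
the type of every character contributing to the slot-`k` theta classes as

  `Φ_{μ_Liu}(Θ_k) = Φ^δ_k(τ′∗) := {τ | 0 < Im τ(δ_L a_k) · Im τ′∗(δ_L a_k)}`,  anchor `τ′∗ = ι₁`,

and under the guard `0 < Im ι₁(δ_L a_k)` (binder-2 #83 `GoodCtx.im_ι₁_eta_mul_a_pos`), so `Φ^δ_k(ι₁) = {τ | 0 < Im τ(δ_L a_k)}`.  This leaf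
makes that set a KERNEL `CMType` for ANY totally real non-zero scalar `a` —

* `HodgeCM.SignRecipe.lineType a ha ha0 : CMType L := {τ | 0 < Im τ(η_L a)}` (`η_L = δ_L` definitionally, #83 `eta_eq_imagUnit`;
  a CM type because `Im τ̄(η a) = −Im τ(η a) ≠ 0`),

and DISCHARGES the (J4a) clause for it at every good context of the bit of record on a normal `L`:

* `HodgeCM.SignRecipe.lineType_eq_liftType_false` — `Φ^δ(a_i) = liftType false K L j ι₁ (Ψ i)` under `SignsForced h` with
  `h = orientBitι L ι₁`, on a full `Aut(L)`-orbit of `ι₁` (= #83 `posImSet_imagUnit_mul_eq_liftType_false_of_orbit` as a `CMType` identity);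
* `HodgeCM.SignRecipe.GoodCtx.liftTyped_lineType` ∕ `…_of_isNormalClosure` — **the (J4a) clause VERBATIM for `Φ := Φ^δ(c.D.a i)`**:
  `∃ j, ι₁.comp j = c.σ ∧ lineType (c.D.a i) _ _ = liftType false c.K L j ι₁ (c.Ψ i)` under `SignRecipe.GoodCtx (orientBitι L ι₁) ι₁ c`
  (= E's guard by `AdelicThetaCore.thetaModel_goodCtx_iff`) and `IsGalois ℚ L` ∕ `IsNormalClosure ℚ c.K L` (E's scope);
  `GoodCtx.self_mem_lineType` — `ι₁ ∈ Φ^δ(c.D.a i)`;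
* `HodgeCM.Model.liftTyped_of_scalar_eq` — for a character type `Char` with a SCALAR map `scalar : Char → L` (totally real, non-zero)
  and `typeOf μ = Φ^δ(scalar μ)`: the (J4a) clause at the corner `(c, i)` holds for every `μ` with `scalar μ = c.D.a i`;
* `HodgeCM.Model.hJ_at_of_scalar_eq` — binder-2 #92's pointwise socket composed with it: from
  `∃ S, (∀ μ ∈ S, scalar μ = c.D.a i) ∧ Q S` to the junction's `∃ S, clause 1 ∧ clause 2 ∧ Q S`.

So once the adèlic-side instance (axioms-1-g15 #4 `liuDictionaryOfWeil … typeOf`) pins `typeOf p := Φ^δ(p's line scalar)` — a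
choice that is the theta lane's to word (K0: on the `Good` locus it must be Liu's `Φ_μ`, which is the READ above) — the first two
clauses of `hJ` cost exactly «the lines feeding slot `i` have scalar `a_i`».  KERNEL: 1 def + theorems; 0 records, nothing cited,
no `def … : Prop`; expected `#print axioms` ⊆ {propext, Classical.choice, Quot.sound}.
-/

noncomputable section

open NumberField NumberField.ComplexEmbedding
open Literature.AlgebraicGeometry.Motives (CMType)
open Literature.AlgebraicGeometry.ShimuraVarieties (conjRingHomK)

namespace HodgeCM

namespace SignRecipe

variable {L : CMField}

/-! ## 1. The δ-positive type of a totally real non-zero scalar -/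

/-- **`Φ^δ(a)`, the δ-positive CM type of the line scalar `a`**: the complex embeddings `τ` of `L` with `0 < Im τ(η_L · a)`
(`η_L = δ_L` the cell's purely imaginary unit).  For `a` totally real (`ā = a`) and non-zero this is a CM type: `Im τ(η a) =
Im τ(η) · Re τ(a)` is non-zero at every `τ` and changes sign under complex conjugation.  (theta-3-g22's `Φ^δ_k(ι₁)` for `a = a_k`
under the guard; [Liu21] Def. 4.12's `{τ′ | Im τ′(e) < 0}` for `e ∈ (L⁺)_{≫0} · (−δ_L a)`.) -/
def lineType (a : L) (ha : conjRingHomK L a = a) (ha0 : a ≠ 0) : CMType L :=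
  ⟨{τ | 0 < (τ (eta L * a)).im}, fun τ => by
    have hne : (τ (eta L * a)).im ≠ 0 := by
      rw [im_embedding_eta_mul]
      exact mul_ne_zero (embedding_eta_im_ne_zero L τ) (re_embedding_ne_zero_of_conj_eq ha ha0 τ)
    change 0 < (τ (eta L * a)).im ↔ ¬ 0 < ((conjugate τ) (eta L * a)).im
    rw [conjugate_coe_eq, Complex.conj_im, neg_pos, not_lt]
    exact ⟨le_of_lt, fun h => lt_of_le_of_ne h hne.symm⟩⟩

/-- (Ported verbatim from the HodgeCMPerL package; no docstring in the source.) -/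
@[simp] theorem mem_lineType_iff {a : L} (ha : conjRingHomK L a = a) (ha0 : a ≠ 0) (τ : L →+* ℂ) :
    τ ∈ (lineType a ha ha0).1 ↔ 0 < (τ (eta L * a)).im := Iff.rfl

/-- (Ported verbatim from the HodgeCMPerL package; no docstring in the source.) -/
theorem lineType_val {a : L} (ha : conjRingHomK L a = a) (ha0 : a ≠ 0) :
    (lineType a ha ha0).1 = {τ : L →+* ℂ | 0 < (τ (eta L * a)).im} := rfl

/-- `Φ^δ` depends on the scalar only (proof-irrelevant in the side conditions). -/
theorem lineType_congr {a b : L} (h : a = b) (ha : conjRingHomK L a = a) (ha0 : a ≠ 0) (hb : conjRingHomK L b = b)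
    (hb0 : b ≠ 0) : lineType a ha ha0 = lineType b hb hb0 := by
  subst h; rfl

/-! ## 2. `Φ^δ(a_i) = liftType false … (Ψ i)` at a good context of the bit of record -/

section Forced

variable {K : CMField} {j : K →+* L} {ι₁ : L →+* ℂ} {Ψ : Fin 4 → CMType K} {D : StubTree.SeesawDatum L}

/-- **`Φ^δ(a_i)` IS the recipe type `liftType false K L j ι₁ (Ψ i)`** whenever the four lines of `D` carry the forced signs of the
bit `h = orientBitι L ι₁` and `ι₁`'s `Aut(L)`-orbit is everything (`L/ℚ` normal) — binder-2 #83
`posImSet_imagUnit_mul_eq_liftType_false_of_orbit` as an identity of CM types. -/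
theorem lineType_eq_liftType_false {h : Bool} (hb : Model.orientBitι L ι₁ = h) (hs : SignsForced h K L j ι₁ Ψ D)
    (horbit : ∀ τ : L →+* ℂ, ∃ g : L ≃+* L, ι₁.comp g.toRingHom = τ) (i : Fin 4) :
    lineType (D.a i) (D.a_real i) (D.a_ne i) = liftType false K L j ι₁ (Ψ i) :=
  Subtype.ext (posImSet_imagUnit_mul_eq_liftType_false_of_orbit hb hs horbit i)

end Forced

namespace GoodCtx

variable {ι₁ : L →+* ℂ} {c : SeesawCtx L}

/-- the orbit hypothesis on a Galois `L`: every complex embedding is `ι₁ ∘ g`. -/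
theorem orbit_of_isGalois [hG : IsGalois ℚ L] (ι₁ τ : L →+* ℂ) : ∃ g : L ≃+* L, ι₁.comp g.toRingHom = τ := by
  obtain ⟨g, hg⟩ := CMTypeOps.exists_eq_comp hG ι₁ τ
  exact ⟨g, hg.symm⟩

/-- `ι₁ ∈ Φ^δ(a_i)` at every good context of the bit of record (#83 `im_ι₁_eta_mul_a_pos`). -/
theorem self_mem_lineType (hc : GoodCtx (Model.orientBitι L ι₁) ι₁ c) (i : Fin 4) :
    ι₁ ∈ (lineType (c.D.a i) (c.D.a_real i) (c.D.a_ne i)).1 :=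
  im_ι₁_eta_mul_a_pos hc i

/-- **THE (J4a) CLAUSE FOR `Φ := Φ^δ(a_i)`, VERBATIM**, at a good context of the bit of record on a Galois `L`:
`∃ j, ι₁ ∘ j = c.σ ∧ Φ^δ(c.D.a i) = liftType false c.K L j ι₁ (c.Ψ i)` (the guard's own `j`). -/
theorem liftTyped_lineType [IsGalois ℚ L] (hc : GoodCtx (Model.orientBitι L ι₁) ι₁ c) (i : Fin 4) :
    ∃ j : c.K →+* L, ι₁.comp j = c.σ ∧
      lineType (c.D.a i) (c.D.a_real i) (c.D.a_ne i) = liftType false c.K L j ι₁ (c.Ψ i) := by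
  obtain ⟨j, hj, hs⟩ := hc.forced
  exact ⟨j, hj, lineType_eq_liftType_false rfl hs (orbit_of_isGalois ι₁) i⟩

/-- … at E's scope (`L` a normal closure of `c.K`; `CMTypeOps.isGaloisRat_of_isNormalClosure`). -/
theorem liftTyped_lineType_of_isNormalClosure (hN : IsNormalClosure ℚ c.K L)
    (hc : GoodCtx (Model.orientBitι L ι₁) ι₁ c) (i : Fin 4) :
    ∃ j : c.K →+* L, ι₁.comp j = c.σ ∧
      lineType (c.D.a i) (c.D.a_real i) (c.D.a_ne i) = liftType false c.K L j ι₁ (c.Ψ i) := by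
  haveI : IsGalois ℚ L := CMTypeOps.isGaloisRat_of_isNormalClosure hN
  exact liftTyped_lineType hc i

end GoodCtx

end SignRecipe

/-! ## 3. Characters typed by a line scalar: the (J4a) clause from `scalar μ = a_i`, and the socket -/

namespace Model

open HodgeCM.SignRecipe (lineType liftType)

variable {L : CMField} {ι₁ : L →+* ℂ}

/-- **(J4a) from a scalar equation.**  For a character type `Char` whose type map is read off a totally real non-zero SCALAR
(`typeOf μ = Φ^δ(scalar μ)`), at a good context of the bit of record on `L` a normal closure of `c.K`: every `μ` whose scalar is the
corner's `a_i` is (J4a)-typed at `(c, i)`. -/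
theorem liftTyped_of_scalar_eq {Char : Type*} (scalar : Char → L) (hreal : ∀ μ, conjRingHomK L (scalar μ) = scalar μ)
    (hne : ∀ μ, scalar μ ≠ 0) (typeOf : Char → CMType L)
    (htypeOf : ∀ μ, typeOf μ = lineType (scalar μ) (hreal μ) (hne μ))
    {c : SeesawCtx L} (hN : IsNormalClosure ℚ c.K L) (hc : SignRecipe.GoodCtx (Model.orientBitι L ι₁) ι₁ c) {i : Fin 4}
    {μ : Char} (hμ : scalar μ = c.D.a i) :
    ∃ j : c.K →+* L, ι₁.comp j = c.σ ∧ typeOf μ = liftType false c.K L j ι₁ (c.Ψ i) := by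
  obtain ⟨j, hj, hji⟩ := SignRecipe.GoodCtx.liftTyped_lineType_of_isNormalClosure hN hc i
  refine ⟨j, hj, ?_⟩
  rw [htypeOf μ, SignRecipe.lineType_congr hμ (hreal μ) (hne μ) (c.D.a_real i) (c.D.a_ne i)]
  exact hji

/-- **THE SOCKET FROM A SCALAR EQUATION** (binder-2 #92 `hJ_at_of_liftTyped` ∘ `liftTyped_of_scalar_eq`): for dictionary data
`(PhiMu, adm)` read off `typeOf = Φ^δ ∘ scalar`, at a good context of the bit of record within E's scope conjunction, a finite set
`S` of characters with `scalar μ = c.D.a i` on `S` and any further clause `Q S` yields the junction's `hJ` datum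
`∃ S, (∀ μ ∈ S, PhiMu μ) ∧ (∀ μ ∈ S, ∀ d, adm μ d → d.IsCorner c.K (c.Ψ i) c.σ) ∧ Q S`. -/
theorem hJ_at_of_scalar_eq {Char : Type*} (PhiMu : Char → Prop) (adm : Char → LiuCMSide → Prop)
    (scalar : Char → L) (hreal : ∀ μ, conjRingHomK L (scalar μ) = scalar μ) (hne : ∀ μ, scalar μ ≠ 0)
    (typeOf : Char → CMType L) (htypeOf : ∀ μ, typeOf μ = lineType (scalar μ) (hreal μ) (hne μ))
    (hPhi : ∀ μ, ι₁ ∈ (typeOf μ).1 → PhiMu μ) (hadm : ∀ μ d, adm μ d → d.IsReflexOfTypeG ι₁ (typeOf μ))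
    {c : SeesawCtx L} (hc : SignRecipe.GoodCtx (Model.orientBitι L ι₁) ι₁ c)
    (h6 : Module.finrank ℚ c.K = 6 ∧ IsNormalClosure ℚ c.K L ∧ (Module.finrank ℚ L = 24 ∨ Module.finrank ℚ L = 48))
    {i : Fin 4} (Q : Finset Char → Prop)
    (hJS : ∃ S : Finset Char, (∀ μ ∈ S, scalar μ = c.D.a i) ∧ Q S) :
    ∃ S : Finset Char,
      (∀ μ ∈ S, PhiMu μ) ∧ (∀ μ ∈ S, ∀ d : LiuCMSide, adm μ d → d.IsCorner c.K (c.Ψ i) c.σ) ∧ Q S := by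
  obtain ⟨S, hS, hQ⟩ := hJS
  exact hJ_at_of_liftTyped PhiMu adm typeOf hPhi hadm (hc.mem i) h6 Q
    ⟨S, fun μ hμ => liftTyped_of_scalar_eq scalar hreal hne typeOf htypeOf h6.2.1 hc (hS μ hμ), hQ⟩

end Model

end HodgeCM

end
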